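import Literature.NumberTheory.LFunctions.MertensElementary
import Mathlib.NumberTheory.AbelSummation
import Mathlib.Analysis.SpecialFunctions.Stirling
import HarnessLib

/-!
# Mertens' first theorem (lower half) and the tail of Mertens' second theorem

Trunk T-ANT (`NumberTheory/LFunctions`), continuing `MertensElementary.lean` (which proves the
*upper* halves `∑_{p ≤ n} log p / p ≤ log n + log 4`, `∑_{p ≤ N} 1/p ≤ log log N + 4`).  Fully
proved, explicit-constant forms of

* `log_sub_three_le_sum_log_div_prime` : `log n - 3 ≤ ∑_{p ≤ n} (log p)/p` (Mertens I, lower half;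
  proof: `n log n - n ≤ log n!` (Stirling, Mathlib), Legendre `v_p(n!) ≤ n/(p-1)` (Mathlib), and
  `∑_{p ≤ n} log p / (p (p-1)) ≤ 2` by the telescoping bound
  `log k / (k (k-1)) ≤ F(k-1) - F(k)`, `F(m) = (2 + log m)/m`);
* `sum_log_div_prime_bounds` : the two-sided real-variable form
  `log t - 4 ≤ ∑_{p ≤ t} log p / p ≤ log t + 2` (`t ≥ 1`);
* `loglog_sub_loglog_le_sum_inv_prime` : the **tail lower bound**
  `∑_{P < p ≤ Q} 1/p ≥ log log Q - log log P - 6 / log P` for real `2 ≤ P ≤ Q`, by Abel summation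
  (Mathlib's `sum_mul_eq_sub_sub_integral_mul` with the weight `1/log t`) and the fundamental theorem
  of calculus for `∫_P^Q (log t - 4)/(t log² t) dt = [log log t + 4/log t]_P^Q`;
  `loglog_sub_loglog_le_sum_inv_prime_Icc` is the same over the primes of `[P, Q]`
  (`(Icc ⌈P⌉₊ ⌊Q⌋₊).filter Nat.Prime`), and `sum_inv_prime_Icc_le` the crude upper bound
  `∑_{P ≤ p ≤ Q} 1/p ≤ log log Q + 4`;
* `prod_one_sub_inv_prime_Icc_le` : the **Mertens product bound over an interval of primes**
  `∏_{P ≤ p ≤ Q} (1 - 1/p) ≤ e^{6/log P} log P / log Q` (`2 ≤ P ≤ Q`).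

The point of the tail form is that its error `6/log P` tends to `0` (an `O(1)` two-sided bound on
`∑_{p ≤ x} 1/p` would only give the product bound up to a constant factor); this is the input
"`∏_{P_j ≤ p ≤ Q_j}(1 - 1/p) ≤ (1 + 1/100) log P_j / log Q_j`" of the sieve step in
Matomäki–Radziwiłł 2016, §9 (decomposition of `Literature.NumberTheory.Sieve.matomaki_radziwill`), consumed by
`Literature/NumberTheory/Sieve/IntervalSieveBound.lean`.  The constants (`3`, `4`, `2`, `6`) are
crude but explicit; Mertens' constants `B₁`, `e^{-γ}` are not needed and not claimed.

## References

* G. H. Hardy, E. M. Wright, *An Introduction to the Theory of Numbers*, 6th ed., OUP 2008: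
  Thm 424–425 (§22.6, `∑_{p ≤ x} log p / p = log x + O(1)`), Thm 427 (§22.7,
  `∑_{p ≤ x} 1/p = log log x + B₁ + O(1/log x)`, proof by partial summation from Thm 425),
  Thm 429 (§22.8, Mertens' product theorem).
* F. Mertens, *Ein Beitrag zur analytischen Zahlentheorie*, J. reine angew. Math. 78 (1874) 46–62.
* K. Matomäki, M. Radziwiłł, Ann. of Math. 183 (2016), §2 and §9 (use of the sieve density bound).

## Mathlib

Used: `Stirling.le_log_factorial_stirling` (`n log n - n + … ≤ log n!`),
`Nat.factorization_factorial_le_div_pred` (Legendre, `v_p(n!) ≤ n/(p-1)`),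
`Real.log_nat_eq_sum_factorization`, `Nat.primesLE` / `Nat.primesLE_eq_filter_range`,
`sum_mul_eq_sub_sub_integral_mul` and `integrableOn_mul_sum_Icc` (Abel summation,
`Mathlib.NumberTheory.AbelSummation`), `intervalIntegral.integral_eq_sub_of_hasDerivAt`,
`MeasureTheory.setIntegral_mono_on`, `Real.one_sub_le_exp_neg`, `Real.exp_sum`; and from
`MertensElementary.lean`: `sum_log_div_prime_le`, `sum_inv_prime_le`.  Mathlib has no Mertens-type
bounds (searched: `Mertens`, `sum_inv_prime`, `primesLE` + `log`).
-/

noncomputable section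

namespace Literature.NumberTheory.LFunctions.MertensBound

open Nat hiding log
open Finset Real

/-! ### `∑_p log p / (p (p - 1))` is bounded -/

/-- The telescoping bound `log k / (k (k-1)) ≤ F(k-1) - F(k)` with `F(m) = (2 + log m)/m`, for
`k ≥ 2` (from `log k - log (k-1) ≤ 1/(k-1)`). [folklore] -/
theorem log_div_mul_pred_le_sub (k : ℕ) (hk : 2 ≤ k) :
    Real.log k / (k * (k - 1)) ≤
      (2 + Real.log (k - 1 : ℕ)) / (k - 1 : ℕ) - (2 + Real.log k) / k := by
  have hk' : (2 : ℝ) ≤ k := by exact_mod_cast hk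
  have hcast : ((k - 1 : ℕ) : ℝ) = (k : ℝ) - 1 := by
    rw [Nat.cast_sub (by omega), Nat.cast_one]
  rw [hcast]
  have h1 : (0 : ℝ) < k - 1 := by linarith
  have h0 : (0 : ℝ) < k := by linarith
  -- `log k - log (k - 1) ≤ 1 / (k - 1)`
  have hlog : Real.log k - Real.log (k - 1) ≤ 1 / (k - 1) := by
    rw [← Real.log_div h0.ne' h1.ne']
    have := Real.log_le_sub_one_of_pos (show (0 : ℝ) < k / (k - 1) by positivity)
    calc Real.log (k / (k - 1)) ≤ k / (k - 1) - 1 := this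
      _ = 1 / (k - 1) := by field_simp; ring
  have hb : 0 ≤ Real.log k := Real.log_nonneg (by linarith)
  have hkey : (k : ℝ) * (Real.log (k - 1) - Real.log k) ≥ -1 - 1 / (k - 1) := by
    have : (k : ℝ) * (Real.log k - Real.log (k - 1)) ≤ k * (1 / (k - 1)) :=
      mul_le_mul_of_nonneg_left hlog h0.le
    have h2 : (k : ℝ) * (1 / (k - 1)) = 1 + 1 / (k - 1) := by field_simp; ring
    linarith
  have h3 : 1 / ((k : ℝ) - 1) ≤ 1 := by
    rw [div_le_one h1]; linarith
  have key : Real.log k ≤ k * (2 + Real.log (k - 1)) - (k - 1) * (2 + Real.log k) := by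
    have : (k : ℝ) * (2 + Real.log (k - 1)) - (k - 1) * (2 + Real.log k) =
        2 + Real.log k + k * (Real.log (k - 1) - Real.log k) := by ring
    rw [this]
    linarith
  calc Real.log k / (k * (k - 1))
      ≤ (k * (2 + Real.log (k - 1)) - (k - 1) * (2 + Real.log k)) / (k * (k - 1)) :=
        div_le_div_of_nonneg_right key (by positivity)
    _ = (2 + Real.log (k - 1)) / (k - 1) - (2 + Real.log k) / k := by
        field_simp

/-- `∑_{2 ≤ k ≤ n} log k / (k (k-1)) ≤ 2 - (2 + log n)/n` for `n ≥ 1` (telescoping). [folklore] -/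
theorem sum_Icc_log_div_mul_pred_le (n : ℕ) (hn : 1 ≤ n) :
    ∑ k ∈ Icc 2 n, Real.log k / (k * (k - 1)) ≤ 2 - (2 + Real.log n) / n := by
  induction n, hn using Nat.le_induction with
  | base => simp
  | succ m hm ih =>
    rw [Finset.sum_Icc_succ_top (by omega), Nat.cast_succ]
    have h := log_div_mul_pred_le_sub (m + 1) (by omega)
    simp only [Nat.add_sub_cancel, Nat.cast_succ, add_sub_cancel_right] at h
    simp only [add_sub_cancel_right]
    linarith

/-- `∑_{p ≤ n} log p / (p (p-1)) ≤ 2`. [folklore] -/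
theorem sum_log_div_mul_pred_le_two (n : ℕ) :
    ∑ p ∈ primesLE n, Real.log p / (p * (p - 1)) ≤ 2 := by
  rcases Nat.eq_zero_or_pos n with rfl | hn
  · simp [show primesLE 0 = ∅ by decide]
  have hsub : primesLE n ⊆ Icc 2 n := by
    intro p hp
    rw [Nat.mem_primesLE] at hp
    exact Finset.mem_Icc.mpr ⟨hp.2.two_le, hp.1⟩
  calc ∑ p ∈ primesLE n, Real.log p / (p * (p - 1))
      ≤ ∑ k ∈ Icc 2 n, Real.log k / (k * (k - 1)) := by
        refine Finset.sum_le_sum_of_subset_of_nonneg hsub fun k hk _ => ?_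
        have hk2 : (2 : ℝ) ≤ k := by exact_mod_cast (Finset.mem_Icc.mp hk).1
        exact div_nonneg (Real.log_nonneg (by linarith)) (by nlinarith)
    _ ≤ 2 - (2 + Real.log n) / n := sum_Icc_log_div_mul_pred_le n hn
    _ ≤ 2 := by
        have : 0 ≤ (2 + Real.log n) / n :=
          div_nonneg (by linarith [Real.log_natCast_nonneg n]) (Nat.cast_nonneg n)
        linarith

/-! ### Mertens' first theorem, lower half -/

/-- `n log n - n ≤ log n!` (from Stirling's lower bound, Mathlib). [folklore] -/
theorem mul_log_sub_le_log_factorial (n : ℕ) : n * Real.log n - n ≤ Real.log (n)! := by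
  rcases Nat.eq_zero_or_pos n with rfl | hn
  · simp
  have h := Stirling.le_log_factorial_stirling hn.ne'
  have h1 : 0 ≤ Real.log n / 2 := by
    have := Real.log_natCast_nonneg n; positivity
  have h2 : 0 ≤ Real.log (2 * Real.pi) / 2 := by
    have : 0 ≤ Real.log (2 * Real.pi) :=
      Real.log_nonneg (by linarith [Real.two_le_pi])
    positivity
  linarith

/-- Legendre, upper form: `log n! ≤ ∑_{p ≤ n} (n/(p-1)) log p` (from `v_p(n!) ≤ n/(p-1)`,
Mathlib's `Nat.factorization_factorial_le_div_pred`). [folklore] -/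
theorem log_factorial_le_sum (n : ℕ) :
    Real.log (n)! ≤ ∑ p ∈ primesLE n, (n : ℝ) / (p - 1) * Real.log p := by
  rw [Real.log_nat_eq_sum_factorization (n)!, Finsupp.sum, Nat.support_factorization]
  have hsub : (n)!.primeFactors ⊆ primesLE n := by
    intro p hp
    have hp' := Nat.mem_primeFactors.mp hp
    rw [Nat.mem_primesLE]
    exact ⟨(Nat.Prime.dvd_factorial hp'.1).mp hp'.2.1, hp'.1⟩
  calc ∑ p ∈ (n)!.primeFactors, ((n)!.factorization p : ℝ) * Real.log p
      ≤ ∑ p ∈ (n)!.primeFactors, (n : ℝ) / (p - 1) * Real.log p := by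
        refine Finset.sum_le_sum fun p hp => ?_
        have hpr := Nat.prime_of_mem_primeFactors hp
        have hp1 : (1 : ℝ) < p := by exact_mod_cast hpr.one_lt
        refine mul_le_mul_of_nonneg_right ?_ (Real.log_nonneg hp1.le)
        calc ((n)!.factorization p : ℝ) ≤ ((n / (p - 1) : ℕ) : ℝ) := by
              exact_mod_cast Nat.factorization_factorial_le_div_pred hpr n
          _ ≤ (n : ℝ) / ((p - 1 : ℕ) : ℝ) := Nat.cast_div_le
          _ = (n : ℝ) / (p - 1) := by
              rw [Nat.cast_sub hpr.one_lt.le, Nat.cast_one]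
    _ ≤ ∑ p ∈ primesLE n, (n : ℝ) / (p - 1) * Real.log p := by
        refine Finset.sum_le_sum_of_subset_of_nonneg hsub fun p hp _ => ?_
        have hp1 : (1 : ℝ) < p := by exact_mod_cast (Nat.mem_primesLE.mp hp).2.one_lt
        exact mul_nonneg (div_nonneg (Nat.cast_nonneg n) (by linarith)) (Real.log_nonneg hp1.le)

/-- **Mertens' first theorem, lower half, explicit**: `log n - 3 ≤ ∑_{p ≤ n} (log p)/p` for every
`n` (Hardy–Wright Thm 425: `∑_{p ≤ x} log p / p = log x + O(1)`).  Proof: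
`n log n - n ≤ log n! ≤ ∑_{p ≤ n} (n/(p-1)) log p = n ∑_{p ≤ n} log p / p + n ∑_{p ≤ n} log p /(p(p-1))`
and `∑_p log p / (p (p-1)) ≤ 2`. [cite: HardyWright2008, Thm 425 (§22.6)] -/
theorem log_sub_three_le_sum_log_div_prime (n : ℕ) :
    Real.log n - 3 ≤ ∑ p ∈ primesLE n, Real.log p / p := by
  rcases Nat.eq_zero_or_pos n with rfl | hn
  · simp [show primesLE 0 = ∅ by decide]
  have hn' : (0 : ℝ) < n := by exact_mod_cast hn
  have h1 := mul_log_sub_le_log_factorial n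
  have h2 := log_factorial_le_sum n
  have h3 := sum_log_div_mul_pred_le_two n
  have hsplit : ∑ p ∈ primesLE n, (n : ℝ) / (p - 1) * Real.log p =
      n * (∑ p ∈ primesLE n, Real.log p / p + ∑ p ∈ primesLE n, Real.log p / (p * (p - 1))) := by
    rw [← Finset.sum_add_distrib, Finset.mul_sum]
    refine Finset.sum_congr rfl fun p hp => ?_
    have hp1 : (1 : ℝ) < p := by exact_mod_cast (Nat.mem_primesLE.mp hp).2.one_lt
    have : (p : ℝ) - 1 ≠ 0 := by linarith
    have : (p : ℝ) ≠ 0 := by linarith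
    field_simp
    ring
  rw [hsplit] at h2
  have h4 : (n : ℝ) * (Real.log n - 3) ≤ n * ∑ p ∈ primesLE n, Real.log p / p := by nlinarith
  exact le_of_mul_le_mul_left h4 hn'

/-! ### Real-variable, two-sided form of Mertens' first theorem -/

/-- `∑_{0 ≤ k ≤ m} [k prime] log k / k = ∑_{p ≤ m} log p / p` (the prime weight in the shape used by
Mathlib's Abel summation). [folklore] -/
theorem sum_Icc_ite_prime_log_div (m : ℕ) :
    ∑ k ∈ Icc 0 m, (if k.Prime then Real.log k / k else 0) = ∑ p ∈ primesLE m, Real.log p / p := by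
  rw [Nat.primesLE_eq_filter_range, Finset.sum_filter, Nat.range_succ_eq_Icc_zero]

/-- Two-sided real-variable Mertens I: for real `t ≥ 1`,
`log t - 4 ≤ ∑_{p ≤ t} log p / p ≤ log t + 2` (`3 + log 2 ≤ 4`, `log 4 ≤ 2`). [cite: HardyWright2008, Thm 425 (§22.6)] -/
theorem sum_log_div_prime_bounds {t : ℝ} (ht : 1 ≤ t) :
    Real.log t - 4 ≤ ∑ p ∈ primesLE ⌊t⌋₊, Real.log p / p ∧
      ∑ p ∈ primesLE ⌊t⌋₊, Real.log p / p ≤ Real.log t + 2 := by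
  have h1 : (1 : ℕ) ≤ ⌊t⌋₊ := Nat.le_floor (by simpa using ht)
  have hfl : (1 : ℝ) ≤ ⌊t⌋₊ := by exact_mod_cast h1
  have hfl' : (⌊t⌋₊ : ℝ) ≤ t := Nat.floor_le (by linarith)
  have hlog4 : Real.log 4 ≤ 2 := by
    rw [show (4 : ℝ) = 2 ^ 2 by norm_num, Real.log_pow]
    have := Real.log_two_lt_d9
    push_cast
    linarith
  have hlog2 : Real.log 2 ≤ 1 := by have := Real.log_two_lt_d9; linarith
  constructor
  · have hlow := log_sub_three_le_sum_log_div_prime ⌊t⌋₊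
    -- `log ⌊t⌋ ≥ log (t/2)`
    have h2 : t / 2 ≤ ⌊t⌋₊ := by
      have := Nat.lt_floor_add_one t
      linarith
    have h3 : Real.log t - Real.log 2 ≤ Real.log ⌊t⌋₊ := by
      rw [← Real.log_div (by linarith) (by norm_num)]
      exact Real.log_le_log (by linarith) h2
    linarith
  · have hup := sum_log_div_prime_le ⌊t⌋₊
    have h3 : Real.log ⌊t⌋₊ ≤ Real.log t := Real.log_le_log (by linarith) hfl'
    linarith

/-! ### The tail of Mertens' second theorem, lower bound -/

/-- **Mertens' second theorem, tail form, lower bound**: for real `2 ≤ P ≤ Q`,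
`∑_{P < p ≤ Q} 1/p ≥ log log Q - log log P - 6 / log P`.  Proof (Hardy–Wright §22.7): Abel
summation `∑_{P<p≤Q} (log p/p) (1/log p) = S(Q)/log Q - S(P)/log P + ∫_P^Q S(t)/(t log² t) dt` with
`S(t) = ∑_{p ≤ t} log p / p ∈ [log t - 4, log t + 2]`, and
`∫_P^Q (log t - 4)/(t log² t) dt = [log log t + 4/log t]_P^Q`.  The printed theorem
(`∑_{p ≤ x} 1/p = log log x + B₁ + O(1/log x)`) implies this with an unspecified constant; the tail form
with the explicit `6` is what the sieve bounds below consume. [cite: HardyWright2008, Thm 427 (§22.7)] -/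
theorem loglog_sub_loglog_le_sum_inv_prime {P Q : ℝ} (hP : 2 ≤ P) (hPQ : P ≤ Q) :
    Real.log (Real.log Q) - Real.log (Real.log P) - 6 / Real.log P ≤
      ∑ p ∈ (Ioc ⌊P⌋₊ ⌊Q⌋₊).filter Nat.Prime, (1 : ℝ) / p := by
  have hP0 : (0 : ℝ) ≤ P := by linarith
  have hQ : 2 ≤ Q := hP.trans hPQ
  -- the prime weight `c(k) = [k prime] log k / k`, the smooth weight `f = 1/log` and its derivative
  set c : ℕ → ℝ := fun k => if k.Prime then Real.log k / k else 0 with hc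
  set f : ℝ → ℝ := fun t => (Real.log t)⁻¹ with hf
  set g : ℝ → ℝ := fun t => -t⁻¹ / Real.log t ^ 2 with hg
  have hderiv : ∀ t : ℝ, 1 < t → HasDerivAt f (g t) t := by
    intro t ht
    exact (Real.hasDerivAt_log (show t ≠ 0 by linarith)).inv (Real.log_pos ht).ne'
  have hmem : ∀ t ∈ Set.Icc P Q, t ∈ ({0}ᶜ : Set ℝ) := fun t ht =>
    Set.mem_compl_singleton_iff.mpr (show (0 : ℝ) < t by linarith [ht.1]).ne'
  have hlogne : ∀ t ∈ Set.Icc P Q, Real.log t ≠ 0 := fun t ht =>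
    (Real.log_pos (by linarith [ht.1])).ne'
  have hgcont : ContinuousOn g (Set.Icc P Q) :=
    ContinuousOn.div (ContinuousOn.neg (continuousOn_inv₀.mono hmem))
      ((Real.continuousOn_log.mono hmem).pow 2) fun t ht => pow_ne_zero _ (hlogne t ht)
  have hf_diff : ∀ t ∈ Set.Icc P Q, DifferentiableAt ℝ f t := fun t ht =>
    (hderiv t (by linarith [ht.1])).differentiableAt
  have hderiv_eq : Set.EqOn g (deriv f) (Set.Icc P Q) := fun t ht =>
    ((hderiv t (by linarith [ht.1])).deriv).symm
  have hg_int : MeasureTheory.IntegrableOn g (Set.Icc P Q) := hgcont.integrableOn_Icc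
  have hf_int : MeasureTheory.IntegrableOn (deriv f) (Set.Icc P Q) :=
    hg_int.congr_fun hderiv_eq measurableSet_Icc
  -- Abel summation
  have habel := sum_mul_eq_sub_sub_integral_mul c hP0 hPQ hf_diff hf_int
  -- the left-hand side is `∑_{P < p ≤ Q} 1/p`
  have hlhs : ∑ k ∈ Ioc ⌊P⌋₊ ⌊Q⌋₊, f k * c k =
      ∑ p ∈ (Ioc ⌊P⌋₊ ⌊Q⌋₊).filter Nat.Prime, (1 : ℝ) / p := by
    rw [Finset.sum_filter]
    refine Finset.sum_congr rfl fun k _ => ?_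
    simp only [hc]
    split_ifs with hk
    · have hk1 : (1 : ℝ) < k := by exact_mod_cast hk.one_lt
      have : Real.log k ≠ 0 := (Real.log_pos hk1).ne'
      show (Real.log k)⁻¹ * (Real.log k / k) = 1 / k
      field_simp
    · simp
  -- the partial sums `S(t)`
  have hS : ∀ t : ℝ, 1 ≤ t →
      Real.log t - 4 ≤ ∑ k ∈ Icc 0 ⌊t⌋₊, c k ∧
        ∑ k ∈ Icc 0 ⌊t⌋₊, c k ≤ Real.log t + 2 := by
    intro t ht
    rw [hc, sum_Icc_ite_prime_log_div]
    exact sum_log_div_prime_bounds ht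
  -- boundary terms
  have hlogP : 0 < Real.log P := Real.log_pos (by linarith)
  have hlogQ : 0 < Real.log Q := Real.log_pos (by linarith)
  have hbQ : 1 - 4 / Real.log Q ≤ f Q * ∑ k ∈ Icc 0 ⌊Q⌋₊, c k := by
    have := (hS Q (by linarith)).1
    calc 1 - 4 / Real.log Q = (Real.log Q)⁻¹ * (Real.log Q - 4) := by field_simp
      _ ≤ (Real.log Q)⁻¹ * ∑ k ∈ Icc 0 ⌊Q⌋₊, c k :=
          mul_le_mul_of_nonneg_left this (inv_nonneg.mpr hlogQ.le)
  have hbP : f P * ∑ k ∈ Icc 0 ⌊P⌋₊, c k ≤ 1 + 2 / Real.log P := by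
    have := (hS P (by linarith)).2
    calc f P * ∑ k ∈ Icc 0 ⌊P⌋₊, c k
        ≤ (Real.log P)⁻¹ * (Real.log P + 2) :=
          mul_le_mul_of_nonneg_left this (inv_nonneg.mpr hlogP.le)
      _ = 1 + 2 / Real.log P := by field_simp
  -- the integral term
  have hint : Real.log (Real.log Q) + 4 / Real.log Q - (Real.log (Real.log P) + 4 / Real.log P) ≤
      -∫ t in Set.Ioc P Q, deriv f t * ∑ k ∈ Icc 0 ⌊t⌋₊, c k := by
    -- replace `deriv f` by `g`
    have h1 : ∫ t in Set.Ioc P Q, deriv f t * ∑ k ∈ Icc 0 ⌊t⌋₊, c k =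
        ∫ t in Set.Ioc P Q, g t * ∑ k ∈ Icc 0 ⌊t⌋₊, c k := by
      refine MeasureTheory.setIntegral_congr_fun measurableSet_Ioc fun t ht => ?_
      rw [hderiv_eq (Set.Ioc_subset_Icc_self ht)]
    rw [h1, ← MeasureTheory.integral_neg]
    -- compare with the explicit integrand `(log t - 4)/(t log² t)`
    set F : ℝ → ℝ := fun t => Real.log (Real.log t) + 4 * (Real.log t)⁻¹ with hF
    set w : ℝ → ℝ := fun t => t⁻¹ / Real.log t ^ 2 * (Real.log t - 4) with hw
    have hFderiv : ∀ t : ℝ, 1 < t → HasDerivAt F (w t) t := by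
      intro t ht
      have ht0 : t ≠ 0 := by linarith
      have hl : Real.log t ≠ 0 := (Real.log_pos ht).ne'
      have hA := (Real.hasDerivAt_log ht0).log hl
      have hB := ((Real.hasDerivAt_log ht0).inv hl).const_mul 4
      have heq : t⁻¹ / Real.log t + 4 * (-t⁻¹ / Real.log t ^ 2) = w t := by
        simp only [hw]
        field_simp
        ring
      exact (hA.add hB).congr_deriv heq
    have hwcont : ContinuousOn w (Set.Icc P Q) :=
      ContinuousOn.mul (ContinuousOn.div (continuousOn_inv₀.mono hmem)
        ((Real.continuousOn_log.mono hmem).pow 2) fun t ht => pow_ne_zero _ (hlogne t ht))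
        ((Real.continuousOn_log.mono hmem).sub continuousOn_const)
    have hFTC : ∫ t in Set.Ioc P Q, w t = F Q - F P := by
      rw [← intervalIntegral.integral_of_le hPQ]
      refine intervalIntegral.integral_eq_sub_of_hasDerivAt (fun t ht => hFderiv t ?_)
        (hwcont.mono ?_).intervalIntegrable
      · rw [Set.uIcc_of_le hPQ] at ht; linarith [ht.1]
      · rw [Set.uIcc_of_le hPQ]
    have hFQP : F Q - F P =
        Real.log (Real.log Q) + 4 / Real.log Q - (Real.log (Real.log P) + 4 / Real.log P) := by
      simp only [hF, div_eq_mul_inv]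
    rw [← hFQP, ← hFTC]
    -- monotonicity of the integral
    have hint1 : MeasureTheory.IntegrableOn w (Set.Ioc P Q) :=
      hwcont.integrableOn_Icc.mono_set Set.Ioc_subset_Icc_self
    have hint2 : MeasureTheory.IntegrableOn
        (fun t => -(g t * ∑ k ∈ Icc 0 ⌊t⌋₊, c k)) (Set.Ioc P Q) :=
      ((integrableOn_mul_sum_Icc c hP0 hg_int).mono_set Set.Ioc_subset_Icc_self).neg
    refine MeasureTheory.setIntegral_mono_on hint1 hint2 measurableSet_Ioc fun t ht => ?_
    have ht1 : 1 < t := by linarith [ht.1]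
    have hpos : 0 ≤ t⁻¹ / Real.log t ^ 2 := by
      have : 0 < t := by linarith
      positivity
    have := (hS t ht1.le).1
    calc w t = t⁻¹ / Real.log t ^ 2 * (Real.log t - 4) := rfl
      _ ≤ t⁻¹ / Real.log t ^ 2 * ∑ k ∈ Icc 0 ⌊t⌋₊, c k :=
          mul_le_mul_of_nonneg_left this hpos
      _ = -(g t * ∑ k ∈ Icc 0 ⌊t⌋₊, c k) := by simp only [hg]; ring
  -- assemble
  rw [← hlhs, habel]
  have e1 : (6 : ℝ) / Real.log P = 2 / Real.log P + 4 / Real.log P := by ring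
  linarith

/-- The primes of the real interval `[P, Q]`: `{p prime : P ≤ p ≤ Q} = {p prime : ⌈P⌉ ≤ p ≤ ⌊Q⌋}`.
Tail lower bound over this set (it contains the primes of `(⌊P⌋, ⌊Q⌋]`). [cite: HardyWright2008, Thm 427 (§22.7)] -/
theorem loglog_sub_loglog_le_sum_inv_prime_Icc {P Q : ℝ} (hP : 2 ≤ P) (hPQ : P ≤ Q) :
    Real.log (Real.log Q) - Real.log (Real.log P) - 6 / Real.log P ≤
      ∑ p ∈ (Icc ⌈P⌉₊ ⌊Q⌋₊).filter Nat.Prime, (1 : ℝ) / p := by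
  refine (loglog_sub_loglog_le_sum_inv_prime hP hPQ).trans
    (Finset.sum_le_sum_of_subset_of_nonneg ?_ fun p _ _ => by positivity)
  intro p hp
  simp only [Finset.mem_filter, Finset.mem_Ioc, Finset.mem_Icc] at hp ⊢
  exact ⟨⟨(Nat.ceil_le_floor_add_one P).trans hp.1.1, hp.1.2⟩, hp.2⟩

/-- Upper bound for the same sum: `∑_{P ≤ p ≤ Q} 1/p ≤ log log Q + 4` (`Q ≥ 2`).
[cite: HardyWright2008, Thm 427 (§22.7)] -/
theorem sum_inv_prime_Icc_le {P Q : ℝ} (hQ : 2 ≤ Q) :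
    ∑ p ∈ (Icc ⌈P⌉₊ ⌊Q⌋₊).filter Nat.Prime, (1 : ℝ) / p ≤ Real.log (Real.log Q) + 4 := by
  have hQ2 : 2 ≤ ⌊Q⌋₊ := Nat.le_floor (by simpa using hQ)
  have hsub : (Icc ⌈P⌉₊ ⌊Q⌋₊).filter Nat.Prime ⊆ primesLE ⌊Q⌋₊ := by
    intro p hp
    simp only [Finset.mem_filter, Finset.mem_Icc] at hp
    exact Nat.mem_primesLE.mpr ⟨hp.1.2, hp.2⟩
  calc ∑ p ∈ (Icc ⌈P⌉₊ ⌊Q⌋₊).filter Nat.Prime, (1 : ℝ) / p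
      ≤ ∑ p ∈ primesLE ⌊Q⌋₊, (1 : ℝ) / p :=
        Finset.sum_le_sum_of_subset_of_nonneg hsub fun p _ _ => by positivity
    _ ≤ Real.log (Real.log ⌊Q⌋₊) + 4 := sum_inv_prime_le ⌊Q⌋₊ hQ2
    _ ≤ Real.log (Real.log Q) + 4 := by
        have h1 : (2 : ℝ) ≤ ⌊Q⌋₊ := by exact_mod_cast hQ2
        have h2 : (⌊Q⌋₊ : ℝ) ≤ Q := Nat.floor_le (by linarith)
        have h3 : 0 < Real.log ⌊Q⌋₊ := Real.log_pos (by linarith)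
        linarith [Real.log_le_log h3 (Real.log_le_log (by linarith) h2)]

/-- **Mertens' product bound over an interval of primes**: for real `2 ≤ P ≤ Q`,
`∏_{P ≤ p ≤ Q} (1 - 1/p) ≤ e^{6/log P} · log P / log Q` (from `1 - x ≤ e^{-x}` and the tail lower
bound; Hardy–Wright Thm 429 is the asymptotic `∏_{p ≤ x}(1 - 1/p) ~ e^{-γ}/log x`).
[cite: HardyWright2008, Thm 429 (§22.8)] -/
theorem prod_one_sub_inv_prime_Icc_le {P Q : ℝ} (hP : 2 ≤ P) (hPQ : P ≤ Q) :
    ∏ p ∈ (Icc ⌈P⌉₊ ⌊Q⌋₊).filter Nat.Prime, (1 - (p : ℝ)⁻¹) ≤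
      Real.exp (6 / Real.log P) * (Real.log P / Real.log Q) := by
  have hlogP : 0 < Real.log P := Real.log_pos (by linarith)
  have hlogQ : 0 < Real.log Q := Real.log_pos (by linarith)
  set s := (Icc ⌈P⌉₊ ⌊Q⌋₊).filter Nat.Prime with hs
  have hmem : ∀ p ∈ s, (2 : ℝ) ≤ p := fun p hp => by
    exact_mod_cast (Finset.mem_filter.mp hp).2.two_le
  calc ∏ p ∈ s, (1 - (p : ℝ)⁻¹) ≤ ∏ p ∈ s, Real.exp (-(p : ℝ)⁻¹) := by
        refine Finset.prod_le_prod (fun p hp => ?_) fun p hp => Real.one_sub_le_exp_neg _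
        have := hmem p hp
        rw [sub_nonneg]
        exact inv_le_one_of_one_le₀ (by linarith)
    _ = Real.exp (-∑ p ∈ s, (1 : ℝ) / p) := by
        rw [← Finset.sum_neg_distrib, Real.exp_sum]
        simp [one_div]
    _ ≤ Real.exp (-(Real.log (Real.log Q) - Real.log (Real.log P) - 6 / Real.log P)) :=
        Real.exp_le_exp.mpr (neg_le_neg (loglog_sub_loglog_le_sum_inv_prime_Icc hP hPQ))
    _ = Real.exp (6 / Real.log P) * (Real.log P / Real.log Q) := by
        rw [show -(Real.log (Real.log Q) - Real.log (Real.log P) - 6 / Real.log P) =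
          6 / Real.log P + Real.log (Real.log P) - Real.log (Real.log Q) by ring,
          Real.exp_sub, Real.exp_add, Real.exp_log hlogP, Real.exp_log hlogQ]
        ring

end Literature.NumberTheory.LFunctions.MertensBound
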